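import Summits.AnomalousDissipation.AnomalousDissipation.Theorems.ImpulseGridGridThesisStubWorkSplitTransfer
import Literature.Analysis.FluidPDE.TimeAverageMeasureBasic

/-!
# Route ImpulseGrid (AnomalousDissipation) — mean energy injection is non-negative; the free half
of the first-moment law

Support file for the crux `GridSignsLaw` (item stmt-AnomalousDissipation-14349), line `Sketch`.
In first-moment form (`gridSignsLaw_iff_firstMomentLaw`) the crux asks, for every bounded-energy
drift family of one grid design, eventually in `j`: DC work `0 ≤ Λ⟨(G,uⱼ)⟩` AND an AC-work floor
`κ ≤ Λ⟨((Φ−1)•G,uⱼ)⟩`. This file records the part of that statement which is FREE: the SUM of the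
two works is the mean energy injection `Λ⟨(Φ•G,uⱼ)⟩`, and the mean injection of any global
Leray–Hopf solution under a steady force is non-negative in every generalized limit
(`impulseGrid_longTimeAvg_injection_nonneg`: the Leray–Hopf energy inequality from `0` gives
`∫₀ᵀ (f,u) ≥ −½‖u₀‖₂²`, so the Cesàro means are `≥ −½‖u₀‖₂²/T → 0`). Hence
`0 ≤ Λ⟨(G,u)⟩ + Λ⟨((Φ−1)•G,u)⟩` along every member of every family
(`firstMoment_dc_add_ac_nonneg`): the law's content is the SPLIT of a non-negative quantity into a
non-negative DC part and an AC part bounded below — equivalently "injection ≥ κ and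
0 ≤ DC ≤ injection − κ".

References: Leray 1934 (5.2); Foias–Manley–Rosa–Temam 2001, Ch. IV §1.3 (1.35)–(1.37);
Doering–Foias 2002 §2. No new definitions.
-/

noncomputable section

-- `Summit.<Summit>.<Problem>` is the tree's mandated summit-side namespace (CONVENTIONS §2); for this
-- single-conjunct summit the two coincide, so the duplicate is deliberate.
set_option linter.dupNamespace false

open MeasureTheory Set Filter Topology
open scoped InnerProductSpace RealInnerProductSpace

namespace Summit.AnomalousDissipation.AnomalousDissipation.Theorems

open Literature.Analysis.FluidPDE Literature.Analysis.FluidPDE.Torus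
open Literature.Analysis.FunctionSpaces Literature.Analysis.FunctionSpaces.Torus

variable {ν : ℝ} {f u₀ : UnitAddTorus (Fin 3) → EuclideanSpace ℝ (Fin 3)}
  {u : ℝ → UnitAddTorus (Fin 3) → EuclideanSpace ℝ (Fin 3)}

/-- **Finite-time injection bound from below.** For a global Leray–Hopf solution under a steady
force `f` with `ν ≥ 0` and every `T > 0`: `T⁻¹ ∫₀ᵀ (f, u) ≥ −(½‖u₀‖₂²)·T⁻¹` (the energy
inequality from `0`, Leray 1934 (5.2), dropping the non-negative kinetic and viscous terms). [folklore] -/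
theorem impulseGrid_timeMean_injection_ge (hν : 0 ≤ ν) (hu : IsGlobalLerayHopf ν (fun _ => f) u₀ u)
    {T : ℝ} (hT : 0 < T) :
    -(kineticEnergy u₀ * T⁻¹) ≤ timeMean (fun t => ∫ x, ⟪f x, u t x⟫) T := by
  have h := (hu T hT).energy_ineq_zero T ⟨hT.le, le_rfl⟩
  have hKE : 0 ≤ kineticEnergy (u T) := kineticEnergy_nonneg _
  have hD : 0 ≤ ν * (∫⁻ τ in Ioo 0 T, eGradNormSq (u τ)).toReal :=
    mul_nonneg hν ENNReal.toReal_nonneg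
  have hI : -kineticEnergy u₀ ≤ ∫ τ in (0 : ℝ)..T, ∫ x, ⟪f x, u τ x⟫ := by
    have : kineticEnergy (u T) + ν * (∫⁻ τ in Ioo 0 T, eGradNormSq (u τ)).toReal ≤
        kineticEnergy u₀ + ∫ τ in (0 : ℝ)..T, ∫ x, ⟪f x, u τ x⟫ := h
    linarith
  unfold timeMean
  have hTi : 0 ≤ T⁻¹ := inv_nonneg.2 hT.le
  calc -(kineticEnergy u₀ * T⁻¹) = T⁻¹ * (-kineticEnergy u₀) := by ring
    _ ≤ T⁻¹ * ∫ τ in (0 : ℝ)..T, ∫ x, ⟪f x, u τ x⟫ := mul_le_mul_of_nonneg_left hI hTi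

/-- **Mean energy injection is non-negative.** For a global Leray–Hopf solution `u` on `T³` under
a steady continuous force `f`, `ν ≥ 0`, with `sup_{t ≥ 0} ½‖u(t)‖₂²` finite, and any generalized
limit `Λ`: `0 ≤ Λ⟨(f, u)⟩`. The Cesàro means are bounded (pairing bounded by the sup energy) and
`≥ −½‖u₀‖₂²/T`, hence eventually `≥ −ε`; positivity of `Λ` (FMRT 2001, Ch. IV (1.37)) gives
`Λ⟨(f,u)⟩ ≥ −ε` for every `ε > 0`. [folklore] -/
theorem impulseGrid_longTimeAvg_injection_nonneg (Λ : GeneralizedLimit) (hν : 0 ≤ ν)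
    (hf : Continuous f) (hu : IsGlobalLerayHopf ν (fun _ => f) u₀ u)
    (hsup : ∃ C : ℝ, ∀ t : ℝ, 0 ≤ t → kineticEnergy (u t) ≤ C) :
    0 ≤ Λ.longTimeAvg (fun t => ∫ x, ⟪f x, u t x⟫) := by
  obtain ⟨C, hC⟩ := hsup
  obtain ⟨K, hK0, hK⟩ := exists_nonneg_forall_norm_le_of_continuous hf
  -- the Cesàro means are bounded above
  have hpt : ∀ t : ℝ, 0 < t → |∫ x, ⟪f x, u t x⟫| ≤ K * (2⁻¹ * (1 + 2 * C)) := by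
    intro t ht
    have h := impulseGrid_abs_integral_inner_le hu hK0 hK hC ht.le
    have hcomm : (∫ x, ⟪f x, u t x⟫) = ∫ x, ⟪u t x, f x⟫ :=
      integral_congr_ae (ae_of_all _ fun x => real_inner_comm _ _)
    rw [hcomm]
    exact h
  have hbdd : IsBoundedUnder (· ≤ ·) atTop (timeMean fun t => ∫ x, ⟪f x, u t x⟫) :=
    isBoundedUnder_le_timeMean hpt
  -- for every `ε > 0` the means are eventually `≥ -ε`
  refine le_of_forall_pos_le_add fun ε hε => ?_
  have hE0 : 0 ≤ kineticEnergy u₀ := kineticEnergy_nonneg _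
  have hev : ∀ᶠ T in atTop, -ε ≤ timeMean (fun t => ∫ x, ⟪f x, u t x⟫) T := by
    filter_upwards [eventually_gt_atTop 0, eventually_ge_atTop (kineticEnergy u₀ / ε)] with T hT hTε
    refine le_trans ?_ (impulseGrid_timeMean_injection_ge hν hu hT)
    -- `E₀ T⁻¹ ≤ ε` since `T ≥ E₀/ε`
    have h1 : kineticEnergy u₀ ≤ ε * T := by
      have := (div_le_iff₀ hε).1 hTε
      linarith [this]
    have h2 : kineticEnergy u₀ * T⁻¹ ≤ ε := by
      rw [← div_eq_mul_inv, div_le_iff₀ hT]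
      exact h1
    linarith
  have h := Λ.le_apply_of_eventually_le hbdd hev
  unfold GeneralizedLimit.longTimeAvg
  linarith

/-- **The free half of the first-moment law: DC work + AC work ≥ 0.** For the grid force `Φ • G`
(`Φ`, `G` continuous), a global Leray–Hopf solution with sup-bounded energy, `ν ≥ 0`, and any
generalized limit: `0 ≤ Λ⟨(G,u)⟩ + Λ⟨((Φ−1)•G,u)⟩` — the sum is the mean injection `Λ⟨(Φ•G,u)⟩`
(`WorkSplitTransfer.longTimeAvg_inner_sub_one_smul`), which is non-negative
(`impulseGrid_longTimeAvg_injection_nonneg`). The crux `GridSignsLaw` in first-moment form asks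
for the SPLIT `0 ≤ Λ⟨(G,u_j)⟩`, `κ ≤ Λ⟨((Φ−1)•G,u_j)⟩` eventually in `j`. [folklore] -/
theorem firstMoment_dc_add_ac_nonneg :
    ∀ (Λ : GeneralizedLimit) (ν : ℝ) (Φ : UnitAddTorus (Fin 3) → ℝ)
      (G u₀ : UnitAddTorus (Fin 3) → EuclideanSpace ℝ (Fin 3))
      (u : ℝ → UnitAddTorus (Fin 3) → EuclideanSpace ℝ (Fin 3)),
      0 ≤ ν → Continuous Φ → Continuous G →
      IsGlobalLerayHopf ν (fun _ => fun x => Φ x • G x) u₀ u →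
      (∃ C : ℝ, ∀ t : ℝ, 0 ≤ t → kineticEnergy (u t) ≤ C) →
      0 ≤ Λ.longTimeAvg (fun t => ∫ x, ⟪G x, u t x⟫) +
        Λ.longTimeAvg (fun t => ∫ x, ⟪(Φ x - 1) • G x, u t x⟫) := by
  intro Λ ν Φ G u₀ u hν hΦ hG hu hsup
  have hsplit := WorkSplitTransfer.longTimeAvg_inner_sub_one_smul Λ hΦ hG hu
  have hinj := impulseGrid_longTimeAvg_injection_nonneg (f := fun x => Φ x • G x) Λ hν
    (hΦ.smul hG) hu hsup
  rw [hsplit]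
  linarith

end Summit.AnomalousDissipation.AnomalousDissipation.Theorems

end
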